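import Mathlib
import Literature.NumberTheory.DiophantineGeometry.AbcWave0
import Literature.Barriers.ABC.BakerMethodBoundsThreeRoutesProofs

/-!
# `DeepRegimeABC` (stmt-ABC-15121), line `SketchIdeator5R2`: the rough reduction (stub S4)

Support file for the crux `Summit.ABC.ABC.Theses.IneffectiveSubspace.DeepRegimeABC`, line
`SketchIdeator5R2` (idea card `ridout-core-exhaustion`, "rough reduction").  Write, for an abc
triple `(a,b,c)` and a cut-off `y`,
* CORE MASS `M_y(a,b,c) := Σ_{p ≤ y, p ∣ abc} v_p(abc)·log p + log (c / min(a,b))`,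
* ROUGH MASS `R_y := Σ_{p > y, p ∣ abc} v_p(abc)·log p`,
* ROUGH POWERFUL EXCESS `X_y := Σ_{p > y, p ∣ abc} (v_p(abc) − 1)·log p`.
The main theorem `stub_roughReduction` is the implication
`RoughPowerfulTailABC → CorelessTailABC` of the line, with both sides written out over existing
declarations only: abc with exponent `1+ε` on the deep tail `{ω₅(abc) ≥ K}` for the triples with
`X_y ≥ θ·log c` (every `0 < θ < ε/(1+ε)`) implies abc with exponent `1+ε` on the deep tail for the
CORELESS triples (`M_y < (2+δ)·log c`), with `y, δ, K, C` of our choosing.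

Proof (mass bookkeeping): `M_y + R_y = log(abc) + log(c/min(a,b)) = log(max(a,b)) + 2 log c ≥
3 log c − log 2`, so a coreless triple has `R_y > (1−δ) log c − log 2`; a violator of
`c < C·rad(abc)^{1+ε}` with `C ≥ 1` has `Σ_{p>y, p∣abc} log p ≤ log rad(abc) ≤ log c/(1+ε)`; hence
`X_y = R_y − Σ_{p>y} log p ≥ θ·log c` for `θ = ε/(2(1+ε))`, `δ = ε/(4(1+ε))` and `c ≥ 2^{1/δ}`.

Sources: elementary (folklore); the decomposition is the one of the planners' sketch
`Summits/ABC/ABC/Cruxes/DeepRegimeABC/SketchIdeator5R2.lean` (`coreMass_add_roughMass`,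
`roughMass_gt_of_coreless`), restated here with the sums written out because a `Theorems` file may
not import a `Cruxes` file; `log n = Σ_{p ∣ n} v_p(n) log p` is reused from
`Literature.Barriers.ABC.log_eq_sum_factorization_mul_log`.  NOT here: the open stub
`RoughPowerfulTailABC` itself (it is the hypothesis `hT`), Ridout's theorem, and the definitions
`coreMass`/`roughMass`/`depth5` (no new definitions are introduced).
-/

-- `Summit.<Summit>.<Problem>` is the mandated summit-side namespace (CONVENTIONS §2); for the
-- single-conjunct summit `ABC` the two coincide, so the duplicate `ABC.ABC` is deliberate.
set_option linter.dupNamespace false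

namespace Summit.ABC.ABC.Theorems.DeepRegimeABC

open Literature.NumberTheory.DiophantineGeometry UniqueFactorizationMonoid

/-- **Coreless ⟹ rough-heavy.**  For an abc triple whose core mass
`Σ_{p ≤ y, p ∣ abc} v_p(abc) log p + log(c/min(a,b))` is `< (2+δ)·log c`, the `y`-rough mass
`Σ_{p > y, p ∣ abc} v_p(abc) log p` exceeds `(1−δ)·log c − log 2`
(`log(abc) + log(c/min(a,b)) = log(max(a,b)) + 2 log c` and `max(a,b) ≥ c/2`). [folklore] -/
theorem roughMass_gt_of_coreMass_lt {y a b c : ℕ} {δ : ℝ} (habc : IsABCTriple a b c)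
    (hcore : (∑ p ∈ (a * b * c).primeFactors.filter (fun p => p ≤ y),
          ((a * b * c).factorization p : ℝ) * Real.log p)
        + Real.log ((c : ℝ) / ((min a b : ℕ) : ℝ)) < (2 + δ) * Real.log c) :
    (1 - δ) * Real.log c - Real.log 2 <
      ∑ p ∈ (a * b * c).primeFactors.filter (fun p => ¬ p ≤ y),
        ((a * b * c).factorization p : ℝ) * Real.log p := by
  -- adapted from Summits/ABC/ABC/Cruxes/DeepRegimeABC/SketchIdeator5R2.lean
  -- (`roughMass_gt_of_coreless`)
  obtain ⟨ha, hb, hsum, -⟩ := habc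
  have hc : 0 < c := by omega
  have habc0 : a * b * c ≠ 0 := by positivity
  -- core + rough = log(abc) + log(c/min)
  have hid : (∑ p ∈ (a * b * c).primeFactors.filter (fun p => p ≤ y),
          ((a * b * c).factorization p : ℝ) * Real.log p)
        + ∑ p ∈ (a * b * c).primeFactors.filter (fun p => ¬ p ≤ y),
          ((a * b * c).factorization p : ℝ) * Real.log p
        = Real.log ((a * b * c : ℕ) : ℝ) := by
    rw [Literature.Barriers.ABC.log_eq_sum_factorization_mul_log habc0,
      Finset.sum_filter_add_sum_filter_not]
  -- log(abc) + log(c/min) = log(max a b) + 2 log c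
  have hmin0 : (0 : ℝ) < ((min a b : ℕ) : ℝ) := by exact_mod_cast lt_min ha hb
  have hmax0 : (0 : ℝ) < ((max a b : ℕ) : ℝ) := by exact_mod_cast lt_max_of_lt_left ha
  have hcR : (0 : ℝ) < (c : ℝ) := by exact_mod_cast hc
  set m : ℝ := ((min a b : ℕ) : ℝ) with hm
  set M : ℝ := ((max a b : ℕ) : ℝ) with hM
  have hminmax : m * M = (a : ℝ) * b := by
    rcases le_total a b with h | h
    · simp [hm, hM, min_eq_left h, max_eq_right h]
    · simp [hm, hM, min_eq_right h, max_eq_left h, mul_comm]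
  have habcR : ((a * b * c : ℕ) : ℝ) = (a : ℝ) * b * c := by push_cast; ring
  have hkey : Real.log ((a * b * c : ℕ) : ℝ) + Real.log ((c : ℝ) / m) =
      Real.log M + 2 * Real.log c := by
    have hprod : ((a * b * c : ℕ) : ℝ) * ((c : ℝ) / m) = M * (c : ℝ) ^ 2 := by
      rw [habcR, ← hminmax]
      field_simp
    rw [← Real.log_mul (by positivity) (by positivity), hprod,
      Real.log_mul (by positivity) (by positivity), Real.log_pow]
    push_cast
    ring
  -- max a b ≥ c/2, i.e. log(max) ≥ log c - log 2
  have hmaxge : (c : ℝ) / 2 ≤ ((max a b : ℕ) : ℝ) := by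
    have : (c : ℝ) ≤ 2 * ((max a b : ℕ) : ℝ) := by
      have h1 : (a : ℝ) ≤ ((max a b : ℕ) : ℝ) := by exact_mod_cast le_max_left a b
      have h2 : (b : ℝ) ≤ ((max a b : ℕ) : ℝ) := by exact_mod_cast le_max_right a b
      have h3 : (c : ℝ) = a + b := by exact_mod_cast hsum.symm
      linarith
    linarith
  have hlogmax : Real.log c - Real.log 2 ≤ Real.log ((max a b : ℕ) : ℝ) := by
    rw [← Real.log_div hcR.ne' (by norm_num)]
    exact Real.log_le_log (by positivity) hmaxge
  linarith [hid, hkey, hlogmax]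

/-- `Σ_{p > y, p ∣ abc} log p ≤ log rad(abc)`: the rough support of `abc` has logarithmic mass at
most `log` of the radical (`rad(abc) = ∏_{p ∣ abc} p` and `log p ≥ 0`). [folklore] -/
theorem sum_rough_log_le_log_rad (y a b c : ℕ) :
    ∑ p ∈ (a * b * c).primeFactors.filter (fun p => ¬ p ≤ y), Real.log p ≤
      Real.log ((rad a b c : ℕ) : ℝ) := by
  rw [rad_def, Nat.radical_eq_prod_primeFactors]
  push_cast
  rw [Real.log_prod]
  · refine Finset.sum_le_sum_of_subset_of_nonneg (Finset.filter_subset _ _) fun p hp _ => ?_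
    exact Real.log_nonneg (by exact_mod_cast (Nat.prime_of_mem_primeFactors hp).one_lt.le)
  · intro p hp
    exact_mod_cast (Nat.prime_of_mem_primeFactors hp).ne_zero

/-- `X_y = R_y − Σ_{p > y, p ∣ abc} log p`: the rough powerful excess is the rough mass minus the
logarithmic mass of the rough support. [folklore] -/
theorem roughExcess_eq_roughMass_sub (y a b c : ℕ) :
    ∑ p ∈ (a * b * c).primeFactors.filter (fun p => ¬ p ≤ y),
        (((a * b * c).factorization p : ℝ) - 1) * Real.log p
      = (∑ p ∈ (a * b * c).primeFactors.filter (fun p => ¬ p ≤ y),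
          ((a * b * c).factorization p : ℝ) * Real.log p)
        - ∑ p ∈ (a * b * c).primeFactors.filter (fun p => ¬ p ≤ y), Real.log p := by
  simp only [sub_mul, one_mul, Finset.sum_sub_distrib]

/-- **S4 — the rough reduction** (`RoughPowerfulTailABC → CorelessTailABC`, both written out).
Given `ε`, take `θ = ε/(2(1+ε))`, the hypothesis' `y, K, C₀`, `δ = ε/(4(1+ε))` and
`C = max C₀ (exp (log 2/δ))`; a coreless deep triple violating `c < C·rad^{1+ε}` has
`Σ_{p>y, p∣abc} log p ≤ log rad ≤ log c/(1+ε)` and rough mass `> (1−δ) log c − log 2`, hence rough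
powerful excess `≥ θ log c` (because `δ·log c ≥ log 2`), so the hypothesis bounds it:
contradiction. [folklore] -/
theorem stub_roughReduction
    (hT : ∀ ε : ℝ, 0 < ε → ∀ θ : ℝ, 0 < θ → θ * (1 + ε) < ε → ∃ y : ℕ, ∃ K : ℕ, ∃ C : ℝ, 0 < C ∧
      ∀ a b c : ℕ, IsABCTriple a b c →
        K ≤ ((a * b * c).primeFactors.filter (fun p => 5 ≤ (a * b * c).factorization p)).card →
        θ * Real.log c ≤
          ∑ p ∈ (a * b * c).primeFactors.filter (fun p => ¬ p ≤ y),
            (((a * b * c).factorization p : ℝ) - 1) * Real.log p →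
        (c : ℝ) < C * ((rad a b c : ℕ) : ℝ) ^ (1 + ε)) :
    ∀ ε : ℝ, 0 < ε → ∃ y : ℕ, ∃ δ : ℝ, 0 < δ ∧ ∃ K : ℕ, ∃ C : ℝ, 0 < C ∧
      ∀ a b c : ℕ, IsABCTriple a b c →
        K ≤ ((a * b * c).primeFactors.filter (fun p => 5 ≤ (a * b * c).factorization p)).card →
        (∑ p ∈ (a * b * c).primeFactors.filter (fun p => p ≤ y),
              ((a * b * c).factorization p : ℝ) * Real.log p)
            + Real.log ((c : ℝ) / ((min a b : ℕ) : ℝ)) < (2 + δ) * Real.log c →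
        (c : ℝ) < C * ((rad a b c : ℕ) : ℝ) ^ (1 + ε) := by
  intro ε hε
  have hε1 : (0 : ℝ) < 1 + ε := by linarith
  -- the parameters: `η = δ = ε/(4(1+ε))`, `θ = 2η`
  set η : ℝ := ε / (4 * (1 + ε)) with hη
  have hη0 : 0 < η := by positivity
  have hη4 : 4 * η * (1 + ε) = ε := by
    rw [hη]
    field_simp
  obtain ⟨y, K, C₀, hC₀, hmain⟩ :=
    hT ε hε (2 * η) (by positivity) (by linarith [hη4])
  set c₁ : ℝ := Real.exp (Real.log 2 / η) with hc₁
  have hc₁1 : 1 ≤ c₁ := Real.one_le_exp (div_nonneg (Real.log_nonneg (by norm_num)) hη0.le)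
  set C : ℝ := max C₀ c₁ with hC
  have hC0 : C₀ ≤ C := le_max_left _ _
  have hC1 : c₁ ≤ C := le_max_right _ _
  have hCone : 1 ≤ C := hc₁1.trans hC1
  refine ⟨y, η, hη0, K, C, lt_max_of_lt_left hC₀, ?_⟩
  intro a b c habc hK hcore
  by_contra hnot
  push Not at hnot
  -- `hnot : C * rad^(1+ε) ≤ c`
  obtain ⟨ha, hb, hsum, -⟩ := id habc
  have hc : 0 < c := by omega
  have hcR : (0 : ℝ) < (c : ℝ) := by exact_mod_cast hc
  have hrad1 : (1 : ℝ) ≤ ((rad a b c : ℕ) : ℝ) := by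
    rw [rad_def]
    exact_mod_cast Nat.pos_of_ne_zero radical_ne_zero
  have hrad0 : (0 : ℝ) < ((rad a b c : ℕ) : ℝ) := by linarith
  have hrpow0 : (0 : ℝ) ≤ ((rad a b c : ℕ) : ℝ) ^ (1 + ε) := Real.rpow_nonneg hrad0.le _
  have hrpow1 : (1 : ℝ) ≤ ((rad a b c : ℕ) : ℝ) ^ (1 + ε) := Real.one_le_rpow hrad1 hε1.le
  -- (a) `c ≥ c₁`, so `η · log c ≥ log 2`; and `rad^(1+ε) ≤ c`, so `(1+ε) log rad ≤ log c`
  have hc_ge : c₁ ≤ (c : ℝ) := by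
    calc c₁ ≤ C := hC1
      _ = C * 1 := (mul_one C).symm
      _ ≤ C * ((rad a b c : ℕ) : ℝ) ^ (1 + ε) :=
          mul_le_mul_of_nonneg_left hrpow1 (by linarith)
      _ ≤ (c : ℝ) := hnot
  have hlogc : Real.log 2 / η ≤ Real.log c := by
    rw [← Real.log_exp (Real.log 2 / η)]
    exact Real.log_le_log (Real.exp_pos _) hc_ge
  have hηL : Real.log 2 ≤ η * Real.log c := by
    rw [div_le_iff₀ hη0] at hlogc
    linarith
  have hrc : ((rad a b c : ℕ) : ℝ) ^ (1 + ε) ≤ (c : ℝ) := by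
    calc ((rad a b c : ℕ) : ℝ) ^ (1 + ε) = 1 * ((rad a b c : ℕ) : ℝ) ^ (1 + ε) := (one_mul _).symm
      _ ≤ C * ((rad a b c : ℕ) : ℝ) ^ (1 + ε) := mul_le_mul_of_nonneg_right hCone hrpow0
      _ ≤ (c : ℝ) := hnot
  have hlogrc : (1 + ε) * Real.log ((rad a b c : ℕ) : ℝ) ≤ Real.log c := by
    have h := Real.log_le_log (by positivity) hrc
    rwa [Real.log_rpow hrad0] at h
  -- (b) the rough support has mass `≤ log rad ≤ log c − 4η log c = log c/(1+ε)`
  have hS := sum_rough_log_le_log_rad y a b c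
  have hρ : Real.log ((rad a b c : ℕ) : ℝ) ≤ Real.log c - 4 * η * Real.log c := by
    have h1 : (1 + ε) * (Real.log c - 4 * η * Real.log c) = Real.log c := by
      have h2 : (1 + ε) * (Real.log c - 4 * η * Real.log c)
          = (1 + ε) * Real.log c - (4 * η * (1 + ε)) * Real.log c := by ring
      rw [h2, hη4]
      ring
    refine le_of_mul_le_mul_left ?_ hε1
    rw [h1]
    exact hlogrc
  -- (c) the rough mass is `> (1−η) log c − log 2`, so the rough excess is `≥ 2η log c = θ log c`
  have hR := roughMass_gt_of_coreMass_lt (y := y) habc hcore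
  have hX : 2 * η * Real.log c ≤
      ∑ p ∈ (a * b * c).primeFactors.filter (fun p => ¬ p ≤ y),
        (((a * b * c).factorization p : ℝ) - 1) * Real.log p := by
    rw [roughExcess_eq_roughMass_sub]
    linarith [hR, hS, hρ, hηL]
  -- (d) the hypothesis bounds the triple: contradiction
  have hlt := hmain a b c habc hK hX
  have hCC : C₀ * ((rad a b c : ℕ) : ℝ) ^ (1 + ε) ≤ C * ((rad a b c : ℕ) : ℝ) ^ (1 + ε) :=
    mul_le_mul_of_nonneg_right hC0 hrpow0
  linarith

end Summit.ABC.ABC.Theorems.DeepRegimeABC
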